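import Summits.BirchSwinnertonDyer.BirchSwinnertonDyer.Theorems.PrintCFramTCubeSumPartnersA
import HarnessLib

/-!
# Route PrintCFram, regime T (`LocalThreeTorsionBSDThree`, stmt-BirchSwinnertonDyer-20699): the 13
# beyond-window cube-sum classes reached by print — their PARTNER members as kernel records,
# part B: Kezuka–Li classes + summary (cell `bsd-print-cfram`, seat p4 g3; display, supports 20699)

HONEST FRAMING (cell `bsd-print-cfram`, run/shared/lean/pub/bsd-print-cfram/, D-0131 (2) print
tier; verbatim in every file of the seat): the cell works the partition leaf
`CornerF ∧ p ramified in the CM field K` (LADDER-BSD row K7r = B13; W-ALL row 12r) in PARTITION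
currency — a leaf or a cell counts only when its theorem is in the kernel BY NAME. Nothing class-wide
is closed here. The seat's T-PRINT CENSUS (kit j285547, HOME/p4/g3/T-PRINT-CENSUS.md, evidence on
stmt-…-20699) found that exactly 19 of the 178 regime-T_cube classes `N < 5·10⁵` are reached by a
PRINTED rank-one `3`-part family, all 19 with kernel records by name — for the 13 beyond-window ones
(b2b `X12/CubeSumFamiliesRecords.lean`) on the cube-sum member `E_n` / `C_{2p^j}` only. Part A (`PrintCFramTCubeSumPartnersA.lean`) + THIS FILE add
the OTHER member of each of those 13 two-curve isogeny classes — the `3`-isogenous partner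
`E_n / ⟨(0, ±√k)⟩` — as an explicit globally minimal equation with `IsElliptic` / `IsGloballyMinimal`
DECIDED in the kernel, its Vélu `3`-isogeny to the printed model PROVED
(`isIsogenous_partner_of_halfScale`, `isIsogenous_partner_cubeSumTwoModel`: tree `isIsogenous_mk_a₆` +
`halfScale_smul`), and `r_an = 1 ∧ BSD(·, 3)` from b2b's isogeny-class consumers
(`CubeSumFamilies.bsdp_three_of_isIsogenous_sylvester / _cubeSumTwoModel / _cubeSum_three_mul(_sq)`:
the family fact + Burungale–Flach Cor. 2 + modularity + Cassels + GZK where printed needs it), plus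
the leaf cell `CornerF · 3` by name (`j = 0`, `r_an = 1` now PROVED from the family fact). Models:
partner of `E_n` (`n` odd) is `y² = x³ + 16n² ≅ [0,0,1,0,(n²−1)/4]`; partner of `C_{2p^j} = [0,0,0,0,−27p^{2j}]`
is `[0,0,0,0,p^{2j}]`. Cremona labels in docstrings are orientation only (census j284048 / j285547).
Theorems + 13 explicit equations (data); no named fact; net Literature debt 0. beyond-print: NO.

References: `X12/CubeSumFamilies{,Records}.lean` (b2b); HOME/p4/g3/T-PRINT-CENSUS.md;
[cite: HuShuYin2019, Thm. 1.4]; [cite: KezukaLi2020, Cor. 1.2 and (4.1)]; [cite: ShuYin2022, Thm. 1.2];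
[cite: BurungaleFlach2024, Cor. 2]; [cite: SilvermanAEC2009, III.4 Remark 4.13.3, VII.1 Remark 1.1];
[cite: MilneADT2006, Thm. I.7.3].
-/

set_option linter.dupNamespace false
set_option autoImplicit false

noncomputable section

open scoped Classical

open WeierstrassCurve Literature.NumberTheory.EllipticCurves
  Literature.NumberTheory.EllipticCurves.Rank1Residual
  Literature.NumberTheory.EllipticCurves.HuShuYin2019
  Literature.NumberTheory.EllipticCurves.Rank1Residual.X12CubeSum
  Summit.BirchSwinnertonDyer.Rank1Residual Summit.BirchSwinnertonDyer.Rank1Residual.X12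

namespace Summit.BirchSwinnertonDyer.BirchSwinnertonDyer.Theorems.PrintCFram.CubeSumPartners

/-! ## §4 Kezuka–Li partners: `C_{2p^j}/⟨(0,±√k)⟩ ≅ y² = x³ + p^{2j}` -/

section KezukaLi

/-- Partner of `C_{1058} = C_{2·23²}` in class 57132b (Cremona 57132b1): `y² = x³ + 279841` (`= 23^4`).
[cite: KezukaLi2020, (4.1) (p. 2139)] -/
def cubeSum1058Partner : WeierstrassCurve ℚ := ⟨0, 0, 0, 0, 279841⟩
/-- `cubeSum1058Partner` is elliptic. [cite: SilvermanAEC2009, III.1] -/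
instance isElliptic_cubeSum1058Partner : cubeSum1058Partner.IsElliptic := isElliptic_mk (by norm_num)
/-- `[0,0,0,0,279841]` is globally minimal (`Δ = −432·23^8`). [cite: SilvermanAEC2009, VII.1 Remark 1.1] -/
instance isGloballyMinimal_cubeSum1058Partner : cubeSum1058Partner.IsGloballyMinimal := by
  have := isGloballyMinimal_mk 0 279841 60 (by norm_num) (by norm_num) (by norm_num) (by decide)
  simpa [cubeSum1058Partner] using this
/-- The Vélu `3`-isogeny `cubeSum1058Partner → C_{1058}` (Kezuka–Li's model (4.1), `p = 23`, `j = 2`).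
[cite: SilvermanAEC2009, III.4 Remark 4.13.3 (Vélu)] -/
theorem isIsogenous_cubeSum1058Partner : IsIsogenous cubeSum1058Partner (KezukaLi2020.cubeSumTwoModel 23 2) := by
  have h := isIsogenous_partner_cubeSumTwoModel (p := 23) (by norm_num) 2
  norm_num at h
  simpa [cubeSum1058Partner] using h
/-- **Partner of `C_{1058}` (class 57132b): `r_an = 1 ∧ BSD(·, 3)`** from Kezuka–Li Cor. 1.2 (2) (`p = 23 ≡ 5 mod 9`)
through the isogeny class (Cassels, modularity). [cite: KezukaLi2020, Cor. 1.2] [cite: MilneADT2006, Thm. I.7.3] -/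
theorem bsdp_three_cubeSum1058Partner (hKL : KezukaLi2020.cor12_threePart_of_cubeSum)
    (hCassels : bsdRHS_eq_of_isIsogenous) (hmod : hasEntireLFunction_rat) :
    cubeSum1058Partner.analyticRank = 1 ∧ BSDp cubeSum1058Partner 3 :=
  CubeSumFamilies.bsdp_three_of_isIsogenous_cubeSumTwoModel hKL hCassels hmod (p := 23) (j := 2)
    (by norm_num) (by norm_num) (Or.inr ⟨by norm_num, rfl⟩) _ isIsogenous_cubeSum1058Partner
/-- **`(57132b1, 3)` is a cell of the leaf `CornerF ∧ CMRamified` at `3`** — `r_an = 1` PROVED from the print.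
[cite: KezukaLi2020, Cor. 1.2] -/
theorem cornerF_three_cubeSum1058Partner (hKL : KezukaLi2020.cor12_threePart_of_cubeSum)
    (hCassels : bsdRHS_eq_of_isIsogenous) (hmod : hasEntireLFunction_rat) : CornerF cubeSum1058Partner 3 :=
  JZeroThree.cornerF_three_of_j_eq_zero _ (j_eq_zero_of_a₁_a₂_a₄ cubeSum1058Partner rfl rfl rfl)
    (bsdp_three_cubeSum1058Partner hKL hCassels hmod).1

/-- Partner of `C_{58} = C_{2·29}` in class 90828j (Cremona 90828j1): `y² = x³ + 841` (`= 29^2`).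
[cite: KezukaLi2020, (4.1) (p. 2139)] -/
def cubeSum58Partner : WeierstrassCurve ℚ := ⟨0, 0, 0, 0, 841⟩
/-- `cubeSum58Partner` is elliptic. [cite: SilvermanAEC2009, III.1] -/
instance isElliptic_cubeSum58Partner : cubeSum58Partner.IsElliptic := isElliptic_mk (by norm_num)
/-- `[0,0,0,0,841]` is globally minimal (`Δ = −432·29^4`). [cite: SilvermanAEC2009, VII.1 Remark 1.1] -/
instance isGloballyMinimal_cubeSum58Partner : cubeSum58Partner.IsGloballyMinimal := by
  have := isGloballyMinimal_mk 0 841 60 (by norm_num) (by norm_num) (by norm_num) (by decide)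
  simpa [cubeSum58Partner] using this
/-- The Vélu `3`-isogeny `cubeSum58Partner → C_{58}` (Kezuka–Li's model (4.1), `p = 29`, `j = 1`).
[cite: SilvermanAEC2009, III.4 Remark 4.13.3 (Vélu)] -/
theorem isIsogenous_cubeSum58Partner : IsIsogenous cubeSum58Partner (KezukaLi2020.cubeSumTwoModel 29 1) := by
  have h := isIsogenous_partner_cubeSumTwoModel (p := 29) (by norm_num) 1
  norm_num at h
  simpa [cubeSum58Partner] using h
/-- **Partner of `C_{58}` (class 90828j): `r_an = 1 ∧ BSD(·, 3)`** from Kezuka–Li Cor. 1.2 (1) (`p = 29 ≡ 2 mod 9`)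
through the isogeny class (Cassels, modularity). [cite: KezukaLi2020, Cor. 1.2] [cite: MilneADT2006, Thm. I.7.3] -/
theorem bsdp_three_cubeSum58Partner (hKL : KezukaLi2020.cor12_threePart_of_cubeSum)
    (hCassels : bsdRHS_eq_of_isIsogenous) (hmod : hasEntireLFunction_rat) :
    cubeSum58Partner.analyticRank = 1 ∧ BSDp cubeSum58Partner 3 :=
  CubeSumFamilies.bsdp_three_of_isIsogenous_cubeSumTwoModel hKL hCassels hmod (p := 29) (j := 1)
    (by norm_num) (by norm_num) (Or.inl ⟨by norm_num, rfl⟩) _ isIsogenous_cubeSum58Partner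
/-- **`(90828j1, 3)` is a cell of the leaf `CornerF ∧ CMRamified` at `3`** — `r_an = 1` PROVED from the print.
[cite: KezukaLi2020, Cor. 1.2] -/
theorem cornerF_three_cubeSum58Partner (hKL : KezukaLi2020.cor12_threePart_of_cubeSum)
    (hCassels : bsdRHS_eq_of_isIsogenous) (hmod : hasEntireLFunction_rat) : CornerF cubeSum58Partner 3 :=
  JZeroThree.cornerF_three_of_j_eq_zero _ (j_eq_zero_of_a₁_a₂_a₄ cubeSum58Partner rfl rfl rfl)
    (bsdp_three_cubeSum58Partner hKL hCassels hmod).1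

/-- Partner of `C_{3362} = C_{2·41²}` in class 181548i (Cremona 181548i1): `y² = x³ + 2825761` (`= 41^4`).
[cite: KezukaLi2020, (4.1) (p. 2139)] -/
def cubeSum3362Partner : WeierstrassCurve ℚ := ⟨0, 0, 0, 0, 2825761⟩
/-- `cubeSum3362Partner` is elliptic. [cite: SilvermanAEC2009, III.1] -/
instance isElliptic_cubeSum3362Partner : cubeSum3362Partner.IsElliptic := isElliptic_mk (by norm_num)
/-- `[0,0,0,0,2825761]` is globally minimal (`Δ = −432·41^8`). [cite: SilvermanAEC2009, VII.1 Remark 1.1] -/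
instance isGloballyMinimal_cubeSum3362Partner : cubeSum3362Partner.IsGloballyMinimal := by
  have := isGloballyMinimal_mk 0 2825761 60 (by norm_num) (by norm_num) (by norm_num) (by decide)
  simpa [cubeSum3362Partner] using this
/-- The Vélu `3`-isogeny `cubeSum3362Partner → C_{3362}` (Kezuka–Li's model (4.1), `p = 41`, `j = 2`).
[cite: SilvermanAEC2009, III.4 Remark 4.13.3 (Vélu)] -/
theorem isIsogenous_cubeSum3362Partner : IsIsogenous cubeSum3362Partner (KezukaLi2020.cubeSumTwoModel 41 2) := by
  have h := isIsogenous_partner_cubeSumTwoModel (p := 41) (by norm_num) 2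
  norm_num at h
  simpa [cubeSum3362Partner] using h
/-- **Partner of `C_{3362}` (class 181548i): `r_an = 1 ∧ BSD(·, 3)`** from Kezuka–Li Cor. 1.2 (2) (`p = 41 ≡ 5 mod 9`)
through the isogeny class (Cassels, modularity). [cite: KezukaLi2020, Cor. 1.2] [cite: MilneADT2006, Thm. I.7.3] -/
theorem bsdp_three_cubeSum3362Partner (hKL : KezukaLi2020.cor12_threePart_of_cubeSum)
    (hCassels : bsdRHS_eq_of_isIsogenous) (hmod : hasEntireLFunction_rat) :
    cubeSum3362Partner.analyticRank = 1 ∧ BSDp cubeSum3362Partner 3 :=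
  CubeSumFamilies.bsdp_three_of_isIsogenous_cubeSumTwoModel hKL hCassels hmod (p := 41) (j := 2)
    (by norm_num) (by norm_num) (Or.inr ⟨by norm_num, rfl⟩) _ isIsogenous_cubeSum3362Partner
/-- **`(181548i1, 3)` is a cell of the leaf `CornerF ∧ CMRamified` at `3`** — `r_an = 1` PROVED from the print.
[cite: KezukaLi2020, Cor. 1.2] -/
theorem cornerF_three_cubeSum3362Partner (hKL : KezukaLi2020.cor12_threePart_of_cubeSum)
    (hCassels : bsdRHS_eq_of_isIsogenous) (hmod : hasEntireLFunction_rat) : CornerF cubeSum3362Partner 3 :=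
  JZeroThree.cornerF_three_of_j_eq_zero _ (j_eq_zero_of_a₁_a₂_a₄ cubeSum3362Partner rfl rfl rfl)
    (bsdp_three_cubeSum3362Partner hKL hCassels hmod).1

/-- Partner of `C_{94} = C_{2·47}` in class 238572i (Cremona 238572i1): `y² = x³ + 2209` (`= 47^2`).
[cite: KezukaLi2020, (4.1) (p. 2139)] -/
def cubeSum94Partner : WeierstrassCurve ℚ := ⟨0, 0, 0, 0, 2209⟩
/-- `cubeSum94Partner` is elliptic. [cite: SilvermanAEC2009, III.1] -/
instance isElliptic_cubeSum94Partner : cubeSum94Partner.IsElliptic := isElliptic_mk (by norm_num)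
/-- `[0,0,0,0,2209]` is globally minimal (`Δ = −432·47^4`). [cite: SilvermanAEC2009, VII.1 Remark 1.1] -/
instance isGloballyMinimal_cubeSum94Partner : cubeSum94Partner.IsGloballyMinimal := by
  have := isGloballyMinimal_mk 0 2209 60 (by norm_num) (by norm_num) (by norm_num) (by decide)
  simpa [cubeSum94Partner] using this
/-- The Vélu `3`-isogeny `cubeSum94Partner → C_{94}` (Kezuka–Li's model (4.1), `p = 47`, `j = 1`).
[cite: SilvermanAEC2009, III.4 Remark 4.13.3 (Vélu)] -/
theorem isIsogenous_cubeSum94Partner : IsIsogenous cubeSum94Partner (KezukaLi2020.cubeSumTwoModel 47 1) := by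
  have h := isIsogenous_partner_cubeSumTwoModel (p := 47) (by norm_num) 1
  norm_num at h
  simpa [cubeSum94Partner] using h
/-- **Partner of `C_{94}` (class 238572i): `r_an = 1 ∧ BSD(·, 3)`** from Kezuka–Li Cor. 1.2 (1) (`p = 47 ≡ 2 mod 9`)
through the isogeny class (Cassels, modularity). [cite: KezukaLi2020, Cor. 1.2] [cite: MilneADT2006, Thm. I.7.3] -/
theorem bsdp_three_cubeSum94Partner (hKL : KezukaLi2020.cor12_threePart_of_cubeSum)
    (hCassels : bsdRHS_eq_of_isIsogenous) (hmod : hasEntireLFunction_rat) :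
    cubeSum94Partner.analyticRank = 1 ∧ BSDp cubeSum94Partner 3 :=
  CubeSumFamilies.bsdp_three_of_isIsogenous_cubeSumTwoModel hKL hCassels hmod (p := 47) (j := 1)
    (by norm_num) (by norm_num) (Or.inl ⟨by norm_num, rfl⟩) _ isIsogenous_cubeSum94Partner
/-- **`(238572i1, 3)` is a cell of the leaf `CornerF ∧ CMRamified` at `3`** — `r_an = 1` PROVED from the print.
[cite: KezukaLi2020, Cor. 1.2] -/
theorem cornerF_three_cubeSum94Partner (hKL : KezukaLi2020.cor12_threePart_of_cubeSum)
    (hCassels : bsdRHS_eq_of_isIsogenous) (hmod : hasEntireLFunction_rat) : CornerF cubeSum94Partner 3 :=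
  JZeroThree.cornerF_three_of_j_eq_zero _ (j_eq_zero_of_a₁_a₂_a₄ cubeSum94Partner rfl rfl rfl)
    (bsdp_three_cubeSum94Partner hKL hCassels hmod).1

/-- Partner of `C_{6962} = C_{2·59²}` in class 375948m (Cremona 375948m1): `y² = x³ + 12117361` (`= 59^4`).
[cite: KezukaLi2020, (4.1) (p. 2139)] -/
def cubeSum6962Partner : WeierstrassCurve ℚ := ⟨0, 0, 0, 0, 12117361⟩
/-- `cubeSum6962Partner` is elliptic. [cite: SilvermanAEC2009, III.1] -/
instance isElliptic_cubeSum6962Partner : cubeSum6962Partner.IsElliptic := isElliptic_mk (by norm_num)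
/-- `[0,0,0,0,12117361]` is globally minimal (`Δ = −432·59^8`). [cite: SilvermanAEC2009, VII.1 Remark 1.1] -/
instance isGloballyMinimal_cubeSum6962Partner : cubeSum6962Partner.IsGloballyMinimal := by
  have := isGloballyMinimal_mk 0 12117361 60 (by norm_num) (by norm_num) (by norm_num) (by decide)
  simpa [cubeSum6962Partner] using this
/-- The Vélu `3`-isogeny `cubeSum6962Partner → C_{6962}` (Kezuka–Li's model (4.1), `p = 59`, `j = 2`).
[cite: SilvermanAEC2009, III.4 Remark 4.13.3 (Vélu)] -/
theorem isIsogenous_cubeSum6962Partner : IsIsogenous cubeSum6962Partner (KezukaLi2020.cubeSumTwoModel 59 2) := by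
  have h := isIsogenous_partner_cubeSumTwoModel (p := 59) (by norm_num) 2
  norm_num at h
  simpa [cubeSum6962Partner] using h
/-- **Partner of `C_{6962}` (class 375948m): `r_an = 1 ∧ BSD(·, 3)`** from Kezuka–Li Cor. 1.2 (2) (`p = 59 ≡ 5 mod 9`)
through the isogeny class (Cassels, modularity). [cite: KezukaLi2020, Cor. 1.2] [cite: MilneADT2006, Thm. I.7.3] -/
theorem bsdp_three_cubeSum6962Partner (hKL : KezukaLi2020.cor12_threePart_of_cubeSum)
    (hCassels : bsdRHS_eq_of_isIsogenous) (hmod : hasEntireLFunction_rat) :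
    cubeSum6962Partner.analyticRank = 1 ∧ BSDp cubeSum6962Partner 3 :=
  CubeSumFamilies.bsdp_three_of_isIsogenous_cubeSumTwoModel hKL hCassels hmod (p := 59) (j := 2)
    (by norm_num) (by norm_num) (Or.inr ⟨by norm_num, rfl⟩) _ isIsogenous_cubeSum6962Partner
/-- **`(375948m1, 3)` is a cell of the leaf `CornerF ∧ CMRamified` at `3`** — `r_an = 1` PROVED from the print.
[cite: KezukaLi2020, Cor. 1.2] -/
theorem cornerF_three_cubeSum6962Partner (hKL : KezukaLi2020.cor12_threePart_of_cubeSum)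
    (hCassels : bsdRHS_eq_of_isIsogenous) (hmod : hasEntireLFunction_rat) : CornerF cubeSum6962Partner 3 :=
  JZeroThree.cornerF_three_of_j_eq_zero _ (j_eq_zero_of_a₁_a₂_a₄ cubeSum6962Partner rfl rfl rfl)
    (bsdp_three_cubeSum6962Partner hKL hCassels hmod).1

end KezukaLi

/-- **Summary.** Given the three printed family theorems, Burungale–Flach Cor. 2, modularity, Cassels'
isogeny invariance and GZK (all named facts of the tree, displayed), `BSD(·, 3)` holds for the 13
explicit PARTNER equations; with b2b's `CubeSumFamilies.bsdp_three_beyond_window_records` every member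
of the 13 beyond-window print-reached T_cube classes is now a kernel record. [cite: HuShuYin2019, Thm. 1.4]
[cite: KezukaLi2020, Cor. 1.2] [cite: ShuYin2022, Thm. 1.2] [cite: BurungaleFlach2024, Cor. 2] -/
theorem bsdp_three_beyond_window_partners (hKL : KezukaLi2020.cor12_threePart_of_cubeSum)
    (hHSY : thm14_threePart_product) (hSY : ShuYin2022.thm12_threePart_product)
    (hCM0 : bsdTriple_of_hasCM_of_L_one_ne_zero) (hmod : hasEntireLFunction_rat)
    (hCassels : bsdRHS_eq_of_isIsogenous) (hGZK : rank_eq_analyticRank_of_analyticRank_le_one) :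
    BSDp cubeSum31Partner 3 ∧ BSDp cubeSum79Partner 3 ∧ BSDp cubeSum97Partner 3 ∧
    BSDp cubeSum223Partner 3 ∧ BSDp cubeSum1058Partner 3 ∧ BSDp cubeSum58Partner 3 ∧
    BSDp cubeSum3362Partner 3 ∧ BSDp cubeSum94Partner 3 ∧ BSDp cubeSum6962Partner 3 ∧
    BSDp cubeSum363Partner 3 ∧ BSDp cubeSum69Partner 3 ∧ BSDp cubeSum2523Partner 3 ∧
    BSDp cubeSum123Partner 3 :=
  ⟨(bsdp_three_cubeSum31Partner hHSY hCM0 hmod hCassels).2,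
    (bsdp_three_cubeSum79Partner hHSY hCM0 hmod hCassels).2,
    (bsdp_three_cubeSum97Partner hHSY hCM0 hmod hCassels).2,
    (bsdp_three_cubeSum223Partner hHSY hCM0 hmod hCassels).2,
    (bsdp_three_cubeSum1058Partner hKL hCassels hmod).2, (bsdp_three_cubeSum58Partner hKL hCassels hmod).2,
    (bsdp_three_cubeSum3362Partner hKL hCassels hmod).2, (bsdp_three_cubeSum94Partner hKL hCassels hmod).2,
    (bsdp_three_cubeSum6962Partner hKL hCassels hmod).2,
    (bsdp_three_cubeSum363Partner hSY hCM0 hmod hCassels hGZK).2,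
    (bsdp_three_cubeSum69Partner hSY hCM0 hmod hCassels hGZK).2,
    (bsdp_three_cubeSum2523Partner hSY hCM0 hmod hCassels hGZK).2,
    (bsdp_three_cubeSum123Partner hSY hCM0 hmod hCassels hGZK).2⟩

end Summit.BirchSwinnertonDyer.BirchSwinnertonDyer.Theorems.PrintCFram.CubeSumPartners

end
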